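import Summits.ValiantsHypothesis.ValiantsHypothesis.Theorems.KPlusLogSqLawTropicalGradedWalkDomXOneGlue1
import Summits.ValiantsHypothesis.ValiantsHypothesis.Theorems.KPlusLogSqLawTropicalGradedWalkDomXOne3
import Summits.ValiantsHypothesis.ValiantsHypothesis.Theorems.KPlusLogSqLawTropicalGradedWalkDomXOne4
import Summits.ValiantsHypothesis.ValiantsHypothesis.Theorems.KPlusLogSqLawTropicalGradedWalkDomXOne5
import Summits.ValiantsHypothesis.ValiantsHypothesis.Theorems.KPlusLogSqLawTropicalGradedWalkDomXOne6
import Summits.ValiantsHypothesis.ValiantsHypothesis.Theorems.KPlusLogSqLawTropicalGradedWalkDomXOne7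

/-!
# Dominance glue for the `u = 1` excursion, part B: lift helpers and the block column `b = 2`

GRW-lite `K = 4` graded-walk family (census side of the tropical root law, all `m`):
dominance glue for the EXCURSION state `(w, 1, 1)`, `2 ≤ w ≤ m − 1` (potential `UX1` of `…PotX`); this part dispatches the rivals
of the block columns `b ≥ 2` (intended row `m − w + b`, class `1`, level `w`; bend `SX1P` at `b = 2`, `SX1L b` at `b ≥ 3`) to the
generated families of `…DomXOne3` – `…DomXOne6`.

Honest framing: census-side (lower-bound) construction; nothing here bears on `TropicalB` inside its window or on VP ≠ VNP.
-/

set_option linter.dupNamespace false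
set_option autoImplicit false

namespace Summit.ValiantsHypothesis.ValiantsHypothesis.Theorems.LacunarySymmetroidMatrixDescartes.TropicalCensus

namespace GradedWalk

open Summit.ValiantsHypothesis.ValiantsHypothesis.Theorems.MatrixDescartes.Negative

variable (n : ℕ)

/-! ### rival weights of upper cells in distance form -/

/-- upper class-`0` rival at distance `D`. -/
theorem X1up0_of {w : ℕ} {a b : Fin (n + 1)} (hab : (a : ℕ) < (b : ℕ)) (D : ℕ) (hD : (a : ℕ) + D = (b : ℕ)) :
    thX n w 1 * (dd n 0 : ℤ) - vv n a b 0 = ((0 : ℤ) - 4 * mZ n * gG n ^ 2 * (((D) : ℕ) : ℤ) ^ 2) := by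
  have hc : (((D) : ℕ) : ℤ) = ((b : ℕ) : ℤ) - ((a : ℕ) : ℤ) := by
    have : ((((a : ℕ) + D : ℕ)) : ℤ) = ((b : ℕ) : ℤ) := by exact_mod_cast hD
    push_cast at this; linarith
  rw [dd_cast_zero, vv_upper_zero n hab, ← hc]; ring

/-- upper class-`1` rival (connector) at distance `D`. -/
theorem X1up1_of {w : ℕ} {a b : Fin (n + 1)} (hab : (a : ℕ) < (b : ℕ)) (D : ℕ) (hD : (a : ℕ) + D = (b : ℕ)) :
    thX n w 1 * (dd n 1 : ℤ) - vv n a b 1 = (thX n w 1 * d1 n - conn n (D) ((b : ℕ))) := by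
  rw [dd_cast_one, vv_upper_one n hab, show (b : ℕ) - (a : ℕ) = D by omega]

/-- the class lift at a future level `E ≥ w + 1` (`E ≤ n`) or at the top level: every present class of a lower / diagonal cell
scores at most the class-`1` value. -/
theorem X1lift_fut {w : ℕ} (hw : 1 < w) (hwn : w ≤ n) {a b : Fin (n + 1)} (l : Fin 4) (hl0 : l ≠ 0) (hp : ee n a b l ≠ 0)
    (hba : (b : ℕ) ≤ (a : ℕ)) (E : ℕ) (hE : n + 1 + (b : ℕ) - (a : ℕ) = E) (hwE : w + 1 ≤ E) :
    thX n w 1 * (dd n l : ℤ) - vv n a b l ≤ thX n w 1 * d1 n - v1 n (E) ((b : ℕ)) := by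
  rcases Nat.eq_or_lt_of_le hba with hab | hlow
  · have hab' : (a : ℕ) = (b : ℕ) := hab.symm
    have hEm : E = n + 1 := by omega
    have hθ : thX n w 1 ≤ LL n * ((n : ℤ) + 1) := thX_le_top n hw hwn
    rcases (show l = 0 ∨ l = 1 ∨ l = 2 ∨ l = 3 by fin_cases l <;> simp) with rfl | rfl | rfl | rfl
    · exact absurd rfl hl0
    · rw [dd_cast_one, vv_diag n hab' 1 (by decide), vblk_one, hEm]
    · rw [dd_cast_two, vv_diag n hab' 2 (by decide), vblk_two, hEm]
      linarith [lift_fut2_top n (θ := thX n w 1) (b : ℕ) hθ]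
    · rw [dd_cast_three, vv_diag n hab' 3 (by decide), vblk_three, hEm]
      linarith [lift_fut3_top n (θ := thX n w 1) (b : ℕ) hθ]
  · have hne1 : E ≠ n + 1 := by omega
    have hθ : thX n w 1 ≤ LL n * ((E : ℕ) : ℤ) := thX_le_LE n hw hwn hwE
    rcases (show l = 0 ∨ l = 1 ∨ l = 2 ∨ l = 3 by fin_cases l <;> simp) with rfl | rfl | rfl | rfl
    · exact absurd (ee_lower_zero n hlow) hp
    · rw [dd_cast_one, vv_lower n hlow, hE, vblk_one]
    · rw [dd_cast_two, vv_lower n hlow, hE, vblk_two, tau2_of_ne n hne1]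
      linarith [lift_fut2 n (θ := thX n w 1) (E := E) (b : ℕ) hθ]
    · rw [dd_cast_three, vv_lower n hlow, hE, vblk_three, tau2_of_ne n hne1, tau3_of_ne n hne1]
      linarith [lift_fut3 n (θ := thX n w 1) (E := E) (b : ℕ) hθ]

/-- the class lift at a past level `E ≤ w − 1`: every present class of a lower cell scores at most the class-`3` value, with a margin
`1` unless the class is `3`. -/
theorem X1lift_past {w : ℕ} {a b : Fin (n + 1)} (l : Fin 4) (hp : ee n a b l ≠ 0)
    (hlow : (b : ℕ) < (a : ℕ)) (E : ℕ) (hE : n + 1 + (b : ℕ) - (a : ℕ) = E) (hEw : E + 1 ≤ w) (hEn : E ≤ n) :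
    thX n w 1 * (dd n l : ℤ) - vv n a b l + (if l = 3 then 0 else 1) ≤
      thX n w 1 * d3 n - ((v1 n (E) ((b : ℕ)) + bB n * tau2lt n (E) ((b : ℕ))) + tau3lt n (E) ((b : ℕ))) := by
  have hne3 : E ≠ n + 1 := by omega
  have hbn : (b : ℕ) ≤ n := by omega
  have hθ : LL n * ((E : ℕ) + 1) ≤ thX n w 1 := by
    have h := LE_le_thX n 1 (show E + 1 ≤ w from hEw)
    exact_mod_cast h
  rcases (show l = 0 ∨ l = 1 ∨ l = 2 ∨ l = 3 by fin_cases l <;> simp) with rfl | rfl | rfl | rfl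
  · exact absurd (ee_lower_zero n hlow) hp
  · rw [dd_cast_one, vv_lower n hlow, hE, vblk_one]
    simp only [show ((1 : Fin 4) = 3) = False by decide, ite_false]
    linarith [lift_past1 n (θ := thX n w 1) (c := (b : ℕ)) (E := E) hbn hEn hθ]
  · rw [dd_cast_two, vv_lower n hlow, hE, vblk_two, tau2_of_ne n hne3]
    simp only [show ((2 : Fin 4) = 3) = False by decide, ite_false]
    linarith [lift_past2 n (θ := thX n w 1) (c := (b : ℕ)) (E := E) hbn hEn hθ]
  · rw [dd_cast_three, vv_lower n hlow, hE, vblk_three, tau2_of_ne n hne3, tau3_of_ne n hne3]; simp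

/-! ### slack, column `2` (`w ≥ 3`) -/

set_option maxHeartbeats 400000 in
/-- slack of the type-X certificate for `u = 1`: the block column `2`. -/
theorem slackX1_c2 (w : ℕ) (hw2 : 2 ≤ w) (hwn : w ≤ n) (a b : Fin (n + 1)) (l : Fin 4)
    (hp : ee n a b l ≠ 0) (hne : perm n w 1 1 b ≠ a ∨ lam n w 1 1 b ≠ l) (hb2 : (b : ℕ) = 2) (hbw : (b : ℕ) < w) :
    1 * (thX n w 1 * (dd n l : ℤ) - vv n a b l) <
      UX1 n w a + ((thX n w 1 * (dd n (lam n w 1 1 b) : ℤ) - vv n (perm n w 1 1 b) b (lam n w 1 1 b)) - UX1 n w (perm n w 1 1 b)) := by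
  have hw1 : w ≤ n + 1 := by omega
  have hw3 : 3 ≤ w := by omega
  have huw : 1 < w := by omega
  have han : (a : ℕ) ≤ n := Nat.lt_succ_iff.mp a.isLt
  have hr : ((perm n w 1 1 b : Fin (n + 1)) : ℕ) = (b : ℕ) + (n + 1 - w) := sigmaX_blk n huw hw1 b hbw (by omega) (by omega)
  rw [hb2] at hr
  rw [lam_X1 n huw, if_neg (by omega), if_neg (by omega)] at hne ⊢
  have hlowr : (b : ℕ) < ((perm n w 1 1 b : Fin (n + 1)) : ℕ) := by rw [hr]; omega
  have hwne : w ≠ n + 1 := by omega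
  have hT1 : thX n w 1 * (dd n 1 : ℤ) - vv n (perm n w 1 1 b) b 1 = thX n w 1 * d1 n - v1 n (w) (2) := by
    rw [dd_cast_one, vv_lower n hlowr, hr, show n + 1 + (b : ℕ) - (2 + (n + 1 - w)) = w by omega, vblk_one, hb2]
  have hUr : UX1 n w ((perm n w 1 1 b : Fin (n + 1)) : ℕ) = gG n * thX n w 1 * (((n + 1 - w + (2)) : ℕ) : ℤ) + SX1P n :=
    UX1_RP n hwn (by rw [hr]; omega)
  clear hlowr
  rcases Nat.lt_or_ge (a : ℕ) (b : ℕ) with hab | hba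
  · -- upper cells: rows `0`, `1`; classes `0`, `1`
    have hl : l = 0 ∨ l = 1 := by
      rcases (show l = 0 ∨ l = 1 ∨ l = 2 ∨ l = 3 by fin_cases l <;> simp) with rfl | rfl | rfl | rfl
      · exact Or.inl rfl
      · exact Or.inr rfl
      · exact absurd (ee_upper_ge_two n hab 2 (by decide)) hp
      · exact absurd (ee_upper_ge_two n hab 3 (by decide)) hp
    rcases Nat.eq_zero_or_pos (a : ℕ) with ha0 | ha1
    · have hY : UX1 n w a - UX1 n w ((perm n w 1 1 b : Fin (n + 1)) : ℕ) =
          ((0 : ℤ) - (gG n * thX n w 1 * (((n + 1 - w + (2)) : ℕ) : ℤ) + SX1P n)) := by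
        rw [hUr, UX1_pre n (show (a : ℕ) ≤ n - w by omega), ha0]; simp
      rcases hl with rfl | rfl
      · exact slack_of (X1_c2_w0_R0 n w hw3 hwn) (by rw [X1up0_of n hab 2 (by omega)]) hT1 hY
      · exact slack_of (X1_c2_cn_R0 n w hw3 hwn) (by rw [X1up1_of n hab 2 (by omega), hb2]) hT1 hY
    · have ha1' : (a : ℕ) = 1 := by omega
      rcases Nat.lt_or_ge w n with hwn' | hwn'
      · have hY : UX1 n w a - UX1 n w ((perm n w 1 1 b : Fin (n + 1)) : ℕ) =
            (gG n * thX n w 1 * (((1) : ℕ) : ℤ) - (gG n * thX n w 1 * (((n + 1 - w + (2)) : ℕ) : ℤ) + SX1P n)) := by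
          rw [hUr, UX1_pre n (show (a : ℕ) ≤ n - w by omega), ha1']
        rcases hl with rfl | rfl
        · exact slack_of (X1_c2_w0_P1 n w hw3 (by omega)) (by rw [X1up0_of n hab 1 (by omega)]) hT1 hY
        · exact slack_of (X1_c2_cn_P1 n w hw3 (by omega)) (by rw [X1up1_of n hab 1 (by omega), hb2]) hT1 hY
      · have hY : UX1 n w a - UX1 n w ((perm n w 1 1 b : Fin (n + 1)) : ℕ) =
            ((gG n * thX n w 1 * (((n + 1 - w + (0)) : ℕ) : ℤ) + SX1R1 n w) - (gG n * thX n w 1 * (((n + 1 - w + (2)) : ℕ) : ℤ) + SX1P n)) := by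
          rw [hUr, UX1_R1 n hwn (by omega)]
        rcases hl with rfl | rfl
        · exact slack_of (X1_c2_w0_P1R1 n w hw3 (by omega)) (by rw [X1up0_of n hab 1 (by omega)]) hT1 hY
        · exact slack_of (X1_c2_cn_P1R1 n w hw3 (by omega)) (by rw [X1up1_of n hab 1 (by omega), hb2]) hT1 hY
  rcases Nat.eq_or_lt_of_le hba with hab | hlow
  · -- the diagonal cell `(2, 2)`
    have hab' : (a : ℕ) = (b : ℕ) := hab.symm
    have hX0 : thX n w 1 * (dd n 0 : ℤ) - vv n a b 0 = thX n w 1 * 0 - 0 := by rw [dd_cast_zero, vv_diag_zero n hab']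
    have hXl : l ≠ 0 → thX n w 1 * (dd n l : ℤ) - vv n a b l ≤ thX n w 1 * d1 n - v1 n (n + 1) (2) := fun hl => by
      have h := X1lift_fut n huw hwn l hl hp hba (n + 1) (by omega) (by omega); rwa [hb2] at h
    rcases Nat.lt_or_ge (w + 1) n with hwa | hwa
    · have hY : UX1 n w a - UX1 n w ((perm n w 1 1 b : Fin (n + 1)) : ℕ) =
          (gG n * thX n w 1 * (((2) : ℕ) : ℤ) - (gG n * thX n w 1 * (((n + 1 - w + (2)) : ℕ) : ℤ) + SX1P n)) := by
        rw [hUr, UX1_pre n (show (a : ℕ) ≤ n - w by omega), show (a : ℕ) = 2 by omega]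
      by_cases hcl : l = 0
      · subst hcl; exact slack_of (X1_c2_dg0_P n w hw3 (by omega)) hX0 hT1 hY
      · exact slack_le (X1_c2_dgm_P n w hw3 (by omega)) (hXl hcl) hT1 hY
    · rcases Nat.lt_or_ge w n with hwb | hwb
      · have hY : UX1 n w a - UX1 n w ((perm n w 1 1 b : Fin (n + 1)) : ℕ) =
            ((gG n * thX n w 1 * (((n + 1 - w + (0)) : ℕ) : ℤ) + SX1R1 n w) - (gG n * thX n w 1 * (((n + 1 - w + (2)) : ℕ) : ℤ) + SX1P n)) := by
          rw [hUr, UX1_R1 n hwn (by omega)]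
        by_cases hcl : l = 0
        · subst hcl; exact slack_of (X1_c2_dg0_R1 n w hw3 (by omega)) hX0 hT1 hY
        · exact slack_le (X1_c2_dgm_R1 n w hw3 (by omega)) (hXl hcl) hT1 hY
      · have hY : UX1 n w a - UX1 n w ((perm n w 1 1 b : Fin (n + 1)) : ℕ) =
            ((gG n * thX n w 1 * (((n + 1 - w + (1)) : ℕ) : ℤ) + SX1R2 n w) - (gG n * thX n w 1 * (((n + 1 - w + (2)) : ℕ) : ℤ) + SX1P n)) := by
          rw [hUr, UX1_R2 n hwn (by omega)]
        by_cases hcl : l = 0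
        · subst hcl; exact slack_of (X1_c2_dg0_R2 n w hw3 (by omega)) hX0 hT1 hY
        · exact slack_le (X1_c2_dgm_R2 n w hw3 (by omega)) (hXl hcl) hT1 hY
  have hcl : l ≠ 0 := fun h0 => by subst h0; exact hp (ee_lower_zero n hlow)
  rcases Nat.lt_or_ge (a : ℕ) (2 + (n + 1 - w)) with hup | hge
  · -- between the diagonal and the intended row: future levels, class 1 best
    obtain ⟨E, hE⟩ : ∃ E, n + 1 + (b : ℕ) - (a : ℕ) = E := ⟨_, rfl⟩
    have hE1 : w + 1 ≤ E := by omega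
    have hXl := X1lift_fut n huw hwn l hcl hp hba E hE hE1
    rw [hb2] at hXl
    rcases Nat.lt_or_ge (a : ℕ) (n + 1 - w) with hpre | hblk
    · have hY : UX1 n w a - UX1 n w ((perm n w 1 1 b : Fin (n + 1)) : ℕ) =
          (gG n * thX n w 1 * (((n + 3 - E) : ℕ) : ℤ) - (gG n * thX n w 1 * (((n + 1 - w + (2)) : ℕ) : ℤ) + SX1P n)) := by
        rw [hUr, UX1_pre n (show (a : ℕ) ≤ n - w by omega), show (a : ℕ) = n + 3 - E by omega]
      exact slack_le (X1_c2_up_P n w E hw3 (by omega) (by omega)) hXl hT1 hY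
    · rcases Nat.lt_or_ge (a : ℕ) (n + 2 - w) with ha1 | ha2
      · have hEq : E = w + 2 := by omega
        subst hEq
        have hY : UX1 n w a - UX1 n w ((perm n w 1 1 b : Fin (n + 1)) : ℕ) =
            ((gG n * thX n w 1 * (((n + 1 - w + (0)) : ℕ) : ℤ) + SX1R1 n w) - (gG n * thX n w 1 * (((n + 1 - w + (2)) : ℕ) : ℤ) + SX1P n)) := by
          rw [hUr, UX1_R1 n hwn (by omega)]
        exact slack_le (X1_c2_up_R1 n w hw3 (by omega)) hXl hT1 hY
      · have hEq : E = w + 1 := by omega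
        subst hEq
        have hY : UX1 n w a - UX1 n w ((perm n w 1 1 b : Fin (n + 1)) : ℕ) =
            ((gG n * thX n w 1 * (((n + 1 - w + (1)) : ℕ) : ℤ) + SX1R2 n w) - (gG n * thX n w 1 * (((n + 1 - w + (2)) : ℕ) : ℤ) + SX1P n)) := by
          rw [hUr, UX1_R2 n hwn (by omega)]
        exact slack_le (X1_c2_up_R2 n w hw3 (by omega)) hXl hT1 hY
  rcases Nat.eq_or_lt_of_le hge with haeq | hagt
  · -- class rivals at the intended cell (level `w`)
    have hrot : perm n w 1 1 b = a := Fin.ext (by rw [hr]; omega)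
    have hY : UX1 n w a - UX1 n w ((perm n w 1 1 b : Fin (n + 1)) : ℕ) = 0 := by rw [hrot]; ring
    have hEa : n + 1 + (b : ℕ) - (a : ℕ) = w := by omega
    rcases (show l = 0 ∨ l = 1 ∨ l = 2 ∨ l = 3 by fin_cases l <;> simp) with rfl | rfl | rfl | rfl
    · exact absurd rfl hcl
    · exact absurd rfl (hne.resolve_left (fun h => h hrot))
    · have hX : thX n w 1 * (dd n 2 : ℤ) - vv n a b 2 = thX n w 1 * d2 n - (v1 n (w) (2) + bB n * tau2lt n (w) (2)) := by
        rw [dd_cast_two, vv_lower n hlow, hEa, vblk_two, tau2_of_ne n hwne, hb2]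
      exact slack_of0 (X1_c2_cls_l2 n w hw3 hwn) hX hT1 hY
    · have hX : thX n w 1 * (dd n 3 : ℤ) - vv n a b 3 = thX n w 1 * d3 n - ((v1 n (w) (2) + bB n * tau2lt n (w) (2)) + tau3lt n (w) (2)) := by
        rw [dd_cast_three, vv_lower n hlow, hEa, vblk_three, tau2_of_ne n hwne, tau3_of_ne n hwne, hb2]
      exact slack_of0 (X1_c2_cls_l3 n w hw3 hwn) hX hT1 hY
  · -- below the intended cell: past levels `w − k`, class 3 best
    obtain ⟨k, hk⟩ : ∃ k, (a : ℕ) = (2 + (n + 1 - w)) + k := ⟨(a : ℕ) - (2 + (n + 1 - w)), by omega⟩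
    have hk1 : 1 ≤ k := by clear hT1 hUr hr; omega
    have hkw : k + 3 ≤ w := by clear hT1 hUr hr; omega
    have hEa : n + 1 + (b : ℕ) - (a : ℕ) = w - k := by clear hT1 hUr hr; omega
    have hlift := X1lift_past n (w := w) l hp hlow (w - k) hEa (by clear hT1 hUr hr hEa; omega) (by clear hT1 hUr hr hEa; omega)
    rw [hb2] at hlift
    have hY : UX1 n w a - UX1 n w ((perm n w 1 1 b : Fin (n + 1)) : ℕ) =
        ((gG n * thX n w 1 * (((n + 1 - w + (2 + k)) : ℕ) : ℤ) + SX1L n w (2 + k)) - (gG n * thX n w 1 * (((n + 1 - w + (2)) : ℕ) : ℤ) + SX1P n)) := by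
      rw [hUr, UX1_RL n (2 + k) hwn (by omega) (by clear hT1 hUr hr hEa hlift; omega)]
    have hF := X1_c2_down n w k hk1 hkw hwn
    exact slack_of (lift_combine hlift hF) rfl hT1 hY

end GradedWalk

end Summit.ValiantsHypothesis.ValiantsHypothesis.Theorems.LacunarySymmetroidMatrixDescartes.TropicalCensus
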